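import Summits.KontsevichZagierPeriods.KontsevichZagierPeriods.Theorems.SymplecticScissorsVolumeFormOffPlaneLogBoxCut
import Mathlib.Analysis.SpecialFunctions.Pow.Real

/-!
# `VolumeFormOffPlane` (stmt-KontsevichZagierPeriods-14935) — line `Sketch`,
stub `stub_mixedSector` (the mixed polygon-cell sector in dimension `3`, bookkeeping)

Given (1) Hilbert III for log-triangles (`tri ~ box`: the log-triangle
`{a < x, b < y, xⁱ yʲ < c, slack}` is KZ-equivalent to the log-box over `(a, b)` with edge ratios
`g = c / (aⁱ bʲ)` and `g ^ (1 / (2 i j))`) and (2) the rank-two toric box sector in real-algebraic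
position (every dimension), two MIXED finite families of log-boxes and log-triangles in dimension
`3` with equal total value are KZ-equivalent as formal sums.

Proof: replace every triangle `T_ν` by its box `B_ν` (it exists by `stub_logBoxCut.1`; (1) gives
`[T_ν] − [B_ν] ∈ relations`, so values agree by soundness of the calculus); the edge ratios of `B_ν`
are `α^{u} β^{v}` and `(α^{u} β^{v})^{1/(2ij)} = α^{u/(2ij)} β^{v/(2ij)}`, again in `α^ℚ β^ℚ` and
`> 1`. Feed (2) at `n = 2` with the enlarged box families (indexed by `Fin (k + m)` through
`Fin.append`) and add back the triangle/box differences.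

Sources: Kontsevich–Zagier 2001, §1.2 (soundness of the moves).
-/

noncomputable section

open MeasureTheory Set
open Literature.NumberTheory.Transcendental

namespace Summit.KontsevichZagierPeriods.SymplecticScissors.LogPolytope

/-! ## Rational powers -/

/-- Rational powers of positive real-algebraic numbers are real algebraic. [folklore] -/
theorem mxs_rpow_isAlgebraic {x : ℝ} (hx : 0 < x) (hxa : IsAlgebraic ℚ x) (q : ℚ) :
    IsAlgebraic ℚ (x ^ ((q : ℚ) : ℝ)) := by
  -- adapted from `toric_rtb_position` (helper H of this line)
  have hden : 0 < q.den := q.den_pos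
  refine IsAlgebraic.of_pow hden ?_
  rw [← Real.rpow_natCast, ← Real.rpow_mul hx.le]
  have : ((q : ℚ) : ℝ) * (q.den : ℝ) = (q.num : ℝ) := by
    have h := Rat.mul_den_eq_num q
    exact_mod_cast congrArg (fun z : ℚ => (z : ℝ)) h
  rw [this, Real.rpow_intCast]
  cases q.num with
  | ofNat m => simpa using hxa.pow m
  | negSucc m => rw [zpow_negSucc]; exact (hxa.pow (m + 1)).inv

/-- `(αˣ βʸ)ᵉ = α^{x e} β^{y e}` for non-negative bases. [folklore] -/
theorem mxs_rpow_pair {α β : ℝ} (hα : 0 ≤ α) (hβ : 0 ≤ β) (x y e : ℝ) :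
    (α ^ x * β ^ y) ^ e = α ^ (x * e) * β ^ (y * e) := by
  rw [Real.mul_rpow (Real.rpow_nonneg hα x) (Real.rpow_nonneg hβ y), Real.rpow_mul hα,
    Real.rpow_mul hβ]

/-- `α^{u/N} β^{v/N} = (αᵘ βᵛ)^{1/N}` with rational exponents. [folklore] -/
theorem mxs_root_eq {α β : ℝ} (hα : 0 ≤ α) (hβ : 0 ≤ β) (tu tv : ℚ) (N : ℕ) :
    α ^ (((tu / (N : ℚ) : ℚ)) : ℝ) * β ^ (((tv / (N : ℚ) : ℚ)) : ℝ) =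
      (α ^ ((tu : ℚ) : ℝ) * β ^ ((tv : ℚ) : ℝ)) ^ ((N : ℝ)⁻¹) := by
  rw [mxs_rpow_pair hα hβ, Rat.cast_div, Rat.cast_div, Rat.cast_natCast, div_eq_mul_inv,
    div_eq_mul_inv]

/-! ## The corners of the box replacing a triangle -/

/-- The upper corners of the box replacing the triangle `{a < x, b < y, xⁱ yʲ < c}` with
`c = aⁱ bʲ αᵘ βᵛ`: `(a g, b g^{1/(2ij)})` with `g = c/(aⁱbʲ) = αᵘ βᵛ`, i.e. edge ratios
`α^{U} β^{V}` with `U = (u, u/(2ij))`, `V = (v, v/(2ij))`. [folklore] -/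
theorem mxs_corner {α β ta tb tc : ℝ} {ti tj : ℕ} {tu tv : ℚ} (hα : 0 ≤ α) (hβ : 0 ≤ β)
    (hta : 0 < ta) (htb : 0 < tb)
    (htc : tc = ta ^ ti * tb ^ tj * (α ^ ((tu : ℚ) : ℝ) * β ^ ((tv : ℚ) : ℝ))) (ι : Fin 2) :
    ![ta, tb] ι * ![tc / (ta ^ ti * tb ^ tj),
        (tc / (ta ^ ti * tb ^ tj)) ^ (((2 * ti * tj : ℕ) : ℝ)⁻¹)] ι =
      ![ta, tb] ι * (α ^ ((![tu, tu / ((2 * ti * tj : ℕ) : ℚ)] ι : ℚ) : ℝ) *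
        β ^ ((![tv, tv / ((2 * ti * tj : ℕ) : ℚ)] ι : ℚ) : ℝ)) := by
  have hP : (0 : ℝ) < ta ^ ti * tb ^ tj := mul_pos (pow_pos hta _) (pow_pos htb _)
  have hg : tc / (ta ^ ti * tb ^ tj) = α ^ ((tu : ℚ) : ℝ) * β ^ ((tv : ℚ) : ℝ) := by
    rw [htc, mul_div_cancel_left₀ _ hP.ne']
  revert ι
  refine Fin.forall_fin_two.mpr ⟨?_, ?_⟩
  · simp only [Matrix.cons_val_zero, hg]
  · simp only [Matrix.cons_val_one, Matrix.cons_val_zero, hg, mxs_root_eq hα hβ]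

/-- The box replacing a triangle, written with edge ratios `α^{U} β^{V}` (the shape of the box
sector) and written with the ratios `(g, g^{1/(2ij)})`, `g = c/(aⁱbʲ)` (the shape of `tri ~ box`),
is the same set. [folklore] -/
theorem mxs_box_eq {α β ta tb tc : ℝ} {ti tj : ℕ} {tu tv : ℚ} (hα : 0 ≤ α) (hβ : 0 ≤ β)
    (hta : 0 < ta) (htb : 0 < tb)
    (htc : tc = ta ^ ti * tb ^ tj * (α ^ ((tu : ℚ) : ℝ) * β ^ ((tv : ℚ) : ℝ))) :
    {p : Fin (2 + 1) → ℝ | (∀ j : Fin 2, ![ta, tb] j < p (Fin.castSucc j) ∧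
        p (Fin.castSucc j) < ![ta, tb] j * (α ^ ((![tu, tu / ((2 * ti * tj : ℕ) : ℚ)] j : ℚ) : ℝ) *
          β ^ ((![tv, tv / ((2 * ti * tj : ℕ) : ℚ)] j : ℚ) : ℝ))) ∧
        0 < p (Fin.last 2) ∧ p (Fin.last 2) * ∏ j : Fin 2, p (Fin.castSucc j) < 1} =
      {p : Fin (2 + 1) → ℝ | (∀ ι : Fin 2, (![ta, tb]) ι < p (Fin.castSucc ι) ∧
        p (Fin.castSucc ι) < ![ta, tb] ι * ![tc / (ta ^ ti * tb ^ tj),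
          (tc / (ta ^ ti * tb ^ tj)) ^ (((2 * ti * tj : ℕ) : ℝ)⁻¹)] ι) ∧
        0 < p (Fin.last 2) ∧ p (Fin.last 2) * ∏ ι : Fin 2, p (Fin.castSucc ι) < 1} := by
  ext p
  simp only [Set.mem_setOf_eq, mxs_corner hα hβ hta htb htc]

/-! ## One side: replacing the triangles of a mixed family by boxes -/

/-- **One side of the mixed sector.** Given `tri ~ box`, a mixed family of `k` log-boxes (position
form, edge ratios `α^u β^v > 1`) and `m` log-triangles (`c = aⁱ bʲ αᵘ βᵛ`, ratio `> 1`) is, as a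
formal sum, KZ-equivalent to a family of `k + m` log-boxes of the same shape with the same total
value. [folklore] -/
theorem mxs_side
    (hTri : ∀ (a b c : ℝ) (i j : ℕ), 0 < a → 0 < b → IsAlgebraic ℚ a → IsAlgebraic ℚ b →
      IsAlgebraic ℚ c → 1 ≤ i → 1 ≤ j → a ^ i * b ^ j < c → ∀ (r r' : KZ.IntegralRep 3),
      r.domain = {p : Fin 3 → ℝ | a < p 0 ∧ b < p 1 ∧ p 0 ^ i * p 1 ^ j < c ∧ 0 < p 2 ∧
        p 2 * (p 0 * p 1) < 1} →
      r'.domain = {p : Fin (2 + 1) → ℝ | (∀ ι : Fin 2, (![a, b]) ι < p (Fin.castSucc ι) ∧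
        p (Fin.castSucc ι) < (fun ι => ![a, b] ι * ![c / (a ^ i * b ^ j),
          (c / (a ^ i * b ^ j)) ^ (((2 * i * j : ℕ) : ℝ)⁻¹)] ι) ι) ∧ 0 < p (Fin.last 2) ∧
        p (Fin.last 2) * ∏ ι : Fin 2, p (Fin.castSucc ι) < 1} →
      (∀ p ∈ r.domain, r.integrand p = 1) → (∀ p ∈ r'.domain, r'.integrand p = 1) →
      KZ.of r - KZ.of r' ∈ KZ.relations)
    {α β : ℝ} (hα : 0 < α) (hβ : 0 < β) (hαa : IsAlgebraic ℚ α) (hβa : IsAlgebraic ℚ β)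
    {k m : ℕ} {a : Fin k → Fin 2 → ℝ} {u v : Fin k → Fin 2 → ℚ} {ta tb tc : Fin m → ℝ}
    {ti tj : Fin m → ℕ} {tu tv : Fin m → ℚ} {rB : Fin k → KZ.IntegralRep 3}
    {rT : Fin m → KZ.IntegralRep 3}
    (ha : ∀ i j, 0 < a i j) (haa : ∀ i j, IsAlgebraic ℚ (a i j))
    (hlt : ∀ i j, 1 < α ^ ((u i j : ℚ) : ℝ) * β ^ ((v i j : ℚ) : ℝ))
    (hrBd : ∀ i, (rB i).domain = {p : Fin (2 + 1) → ℝ | (∀ j : Fin 2, a i j < p (Fin.castSucc j) ∧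
      p (Fin.castSucc j) < a i j * (α ^ ((u i j : ℚ) : ℝ) * β ^ ((v i j : ℚ) : ℝ))) ∧
      0 < p (Fin.last 2) ∧ p (Fin.last 2) * ∏ j : Fin 2, p (Fin.castSucc j) < 1})
    (hrBi : ∀ i, ∀ p ∈ (rB i).domain, (rB i).integrand p = 1)
    (hta : ∀ ν, 0 < ta ν) (htb : ∀ ν, 0 < tb ν) (htaa : ∀ ν, IsAlgebraic ℚ (ta ν))
    (htba : ∀ ν, IsAlgebraic ℚ (tb ν)) (htca : ∀ ν, IsAlgebraic ℚ (tc ν))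
    (hti : ∀ ν, 1 ≤ ti ν) (htj : ∀ ν, 1 ≤ tj ν)
    (htc : ∀ ν, tc ν = ta ν ^ ti ν * tb ν ^ tj ν * (α ^ ((tu ν : ℚ) : ℝ) * β ^ ((tv ν : ℚ) : ℝ)))
    (hltT : ∀ ν, 1 < α ^ ((tu ν : ℚ) : ℝ) * β ^ ((tv ν : ℚ) : ℝ))
    (hrTd : ∀ ν, (rT ν).domain = {p : Fin 3 → ℝ | ta ν < p 0 ∧ tb ν < p 1 ∧
      p 0 ^ ti ν * p 1 ^ tj ν < tc ν ∧ 0 < p 2 ∧ p 2 * (p 0 * p 1) < 1})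
    (hrTi : ∀ ν, ∀ p ∈ (rT ν).domain, (rT ν).integrand p = 1) :
    ∃ (A : Fin (k + m) → Fin 2 → ℝ) (U V : Fin (k + m) → Fin 2 → ℚ)
      (R : Fin (k + m) → KZ.IntegralRep (2 + 1)),
      (∀ i j, 0 < A i j) ∧ (∀ i j, IsAlgebraic ℚ (A i j)) ∧
      (∀ i j, 1 < α ^ ((U i j : ℚ) : ℝ) * β ^ ((V i j : ℚ) : ℝ)) ∧
      (∀ i, (R i).domain = {p : Fin (2 + 1) → ℝ | (∀ j : Fin 2, A i j < p (Fin.castSucc j) ∧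
        p (Fin.castSucc j) < A i j * (α ^ ((U i j : ℚ) : ℝ) * β ^ ((V i j : ℚ) : ℝ))) ∧
        0 < p (Fin.last 2) ∧ p (Fin.last 2) * ∏ j : Fin 2, p (Fin.castSucc j) < 1}) ∧
      (∀ i, ∀ p ∈ (R i).domain, (R i).integrand p = 1) ∧
      ∑ i, (R i).value = ∑ ν, (rB ν).value + ∑ ν, (rT ν).value ∧
      ∑ i, KZ.of (R i) - (∑ ν, KZ.of (rB ν) + ∑ ν, KZ.of (rT ν)) ∈ KZ.relations := by
  have hcor : ∀ uu vv : ℚ, IsAlgebraic ℚ (α ^ ((uu : ℚ) : ℝ) * β ^ ((vv : ℚ) : ℝ)) :=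
    fun uu vv => (mxs_rpow_isAlgebraic hα hαa uu).mul (mxs_rpow_isAlgebraic hβ hβa vv)
  have hTa : ∀ ν, ∀ j : Fin 2, 0 < ![ta ν, tb ν] j := fun ν =>
    Fin.forall_fin_two.mpr ⟨hta ν, htb ν⟩
  have hTaa : ∀ ν, ∀ j : Fin 2, IsAlgebraic ℚ (![ta ν, tb ν] j) := fun ν =>
    Fin.forall_fin_two.mpr ⟨htaa ν, htba ν⟩
  have hN : ∀ ν, (0 : ℝ) < ((2 * ti ν * tj ν : ℕ) : ℝ) := fun ν =>
    Nat.cast_pos.mpr (Nat.mul_pos (Nat.mul_pos two_pos (hti ν)) (htj ν))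
  -- the ratios `α^{U ν j} β^{V ν j}` of the replacement boxes exceed `1`
  have hTlt : ∀ ν, ∀ j : Fin 2, 1 < α ^ ((![tu ν, tu ν / ((2 * ti ν * tj ν : ℕ) : ℚ)] j : ℚ) : ℝ) *
      β ^ ((![tv ν, tv ν / ((2 * ti ν * tj ν : ℕ) : ℚ)] j : ℚ) : ℝ) := fun ν => by
    refine Fin.forall_fin_two.mpr ⟨?_, ?_⟩
    · simpa only [Matrix.cons_val_zero] using hltT ν
    · simp only [Matrix.cons_val_one, Matrix.cons_val_zero]
      rw [mxs_root_eq hα.le hβ.le]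
      exact Real.one_lt_rpow (hltT ν) (inv_pos.mpr (hN ν))
  -- the replacement boxes
  have hexT : ∀ ν : Fin m, ∃ r : KZ.IntegralRep (2 + 1),
      r.domain = {p : Fin (2 + 1) → ℝ | (∀ j : Fin 2, ![ta ν, tb ν] j < p (Fin.castSucc j) ∧
        p (Fin.castSucc j) < ![ta ν, tb ν] j *
          (α ^ ((![tu ν, tu ν / ((2 * ti ν * tj ν : ℕ) : ℚ)] j : ℚ) : ℝ) *
            β ^ ((![tv ν, tv ν / ((2 * ti ν * tj ν : ℕ) : ℚ)] j : ℚ) : ℝ))) ∧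
        0 < p (Fin.last 2) ∧ p (Fin.last 2) * ∏ j : Fin 2, p (Fin.castSucc j) < 1} ∧
      r.integrand = fun _ => 1 := fun ν =>
    stub_logBoxCut.1 2 (![ta ν, tb ν]) (fun j => ![ta ν, tb ν] j *
      (α ^ ((![tu ν, tu ν / ((2 * ti ν * tj ν : ℕ) : ℚ)] j : ℚ) : ℝ) *
        β ^ ((![tv ν, tv ν / ((2 * ti ν * tj ν : ℕ) : ℚ)] j : ℚ) : ℝ)))
      (hTa ν) (hTaa ν) (fun j => (hTaa ν j).mul (hcor _ _))
  choose bT hbTd hbTi using hexT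
  have hbTi' : ∀ ν, ∀ p ∈ (bT ν).domain, (bT ν).integrand p = 1 := fun ν p _ => by
    rw [hbTi ν]
  -- `tri ~ box`, and equality of values by soundness of the calculus
  have hTB : ∀ ν, KZ.of (rT ν) - KZ.of (bT ν) ∈ KZ.relations := fun ν => by
    have hP : (0 : ℝ) < ta ν ^ ti ν * tb ν ^ tj ν :=
      mul_pos (pow_pos (hta ν) _) (pow_pos (htb ν) _)
    refine hTri (ta ν) (tb ν) (tc ν) (ti ν) (tj ν) (hta ν) (htb ν) (htaa ν) (htba ν) (htca ν)
      (hti ν) (htj ν) ?_ (rT ν) (bT ν) (hrTd ν) ?_ (hrTi ν) (hbTi' ν)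
    · rw [htc ν]
      exact lt_mul_of_one_lt_right hP (hltT ν)
    · rw [hbTd ν]
      exact mxs_box_eq hα.le hβ.le (hta ν) (htb ν) (htc ν)
  have hval : ∀ ν, (bT ν).value = (rT ν).value := fun ν =>
    (KZ.Equivalent.value_eq_holds (hTB ν)).symm
  -- the enlarged box family
  refine ⟨Fin.append a (fun ν => ![ta ν, tb ν]),
    Fin.append u (fun ν => ![tu ν, tu ν / ((2 * ti ν * tj ν : ℕ) : ℚ)]),
    Fin.append v (fun ν => ![tv ν, tv ν / ((2 * ti ν * tj ν : ℕ) : ℚ)]),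
    Fin.append rB bT, ?_, ?_, ?_, ?_, ?_, ?_, ?_⟩
  · intro i
    induction i using Fin.addCases with
    | left i => simp only [Fin.append_left]; exact ha i
    | right ν => simp only [Fin.append_right]; exact hTa ν
  · intro i
    induction i using Fin.addCases with
    | left i => simp only [Fin.append_left]; exact haa i
    | right ν => simp only [Fin.append_right]; exact hTaa ν
  · intro i
    induction i using Fin.addCases with
    | left i => simp only [Fin.append_left]; exact hlt i
    | right ν => simp only [Fin.append_right]; exact hTlt ν
  · intro i
    induction i using Fin.addCases with
    | left i => simp only [Fin.append_left]; exact hrBd i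
    | right ν => simp only [Fin.append_right]; exact hbTd ν
  · intro i
    induction i using Fin.addCases with
    | left i => simp only [Fin.append_left]; exact hrBi i
    | right ν => simp only [Fin.append_right]; exact hbTi' ν
  · simp only [Fin.sum_univ_add, Fin.append_left, Fin.append_right, hval]
  · rw [Fin.sum_univ_add]
    simp only [Fin.append_left, Fin.append_right]
    have : ∑ i, KZ.of (rB i) + ∑ ν, KZ.of (bT ν) - (∑ ν, KZ.of (rB ν) + ∑ ν, KZ.of (rT ν)) =
        ∑ ν, (KZ.of (bT ν) - KZ.of (rT ν)) := by
      rw [Finset.sum_sub_distrib]; abel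
    rw [this]
    exact sum_mem fun ν _ => by rw [← neg_sub]; exact KZ.relations.neg_mem (hTB ν)

/-! ## The stub -/

/-- **Stub (the mixed polygon-cell sector, bookkeeping).** Given `stub_triToBox`'s conclusion and
the landed position-form box sector: for `α, β > 0` real algebraic and multiplicatively
independent, two mixed finite families of log-boxes (real-algebraic position, edge ratios in
`α^ℚ β^ℚ`, `> 1`) and log-triangles (`c = aⁱbʲ·α^u β^v`, `u, v ∈ ℚ`, ratio `> 1`) with equal total
value are KZ-equivalent as formal sums (replace every triangle by its box, values are preserved by
soundness, apply the box sector to the enlarged box families). [folklore] -/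
theorem stub_mixedSector : (∀ (a b c : ℝ) (i j : ℕ), 0 < a → 0 < b → IsAlgebraic ℚ a → IsAlgebraic ℚ b → IsAlgebraic ℚ c → 1 ≤ i → 1 ≤ j → a ^ i * b ^ j < c → ∀ (r r' : KZ.IntegralRep 3), r.domain = {p : Fin 3 → ℝ | a < p 0 ∧ b < p 1 ∧ p 0 ^ i * p 1 ^ j < c ∧ 0 < p 2 ∧ p 2 * (p 0 * p 1) < 1} → r'.domain = {p : Fin (2 + 1) → ℝ | (∀ ι : Fin 2, (![a, b]) ι < p (Fin.castSucc ι) ∧ p (Fin.castSucc ι) < (fun ι => ![a, b] ι * ![c / (a ^ i * b ^ j), (c / (a ^ i * b ^ j)) ^ (((2 * i * j : ℕ) : ℝ)⁻¹)] ι) ι) ∧ 0 < p (Fin.last 2) ∧ p (Fin.last 2) * ∏ ι : Fin 2, p (Fin.castSucc ι) < 1} → (∀ p ∈ r.domain, r.integrand p = 1) → (∀ p ∈ r'.domain, r'.integrand p = 1) → KZ.of r - KZ.of r' ∈ KZ.relations) → (∀ (n : ℕ) (α β : ℝ), 0 < α → 0 < β → IsAlgebraic ℚ α → IsAlgebraic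 ℚ β → (∀ p q : ℤ, α ^ p * β ^ q = 1 → p = 0 ∧ q = 0) → ∀ (k k' : ℕ) (a : Fin k → Fin n → ℝ) (u v : Fin k → Fin n → ℚ) (a' : Fin k' → Fin n → ℝ) (s t : Fin k' → Fin n → ℚ) (r : Fin k → KZ.IntegralRep (n + 1)) (r' : Fin k' → KZ.IntegralRep (n + 1)), (∀ i j, 0 < a i j) → (∀ i j, IsAlgebraic ℚ (a i j)) → (∀ i j, 1 < α ^ ((u i j : ℚ) : ℝ) * β ^ ((v i j : ℚ) : ℝ)) → (∀ i j, 0 < a' i j) → (∀ i j, IsAlgebraic ℚ (a' i j)) → (∀ i j, 1 < α ^ ((s i j : ℚ) : ℝ) * β ^ ((t i j : ℚ) : ℝ)) → (∀ i, (r i).domain = {p : Fin (n + 1) → ℝ | (∀ j : Fin n, a i j < p (Fin.castSucc j) ∧ p (Fin.castSucc j) < a i j * (α ^ ((u i j : ℚ) : ℝ) * β ^ ((v i j : ℚ) : ℝ))) ∧ 0 < p (Fin.last n) ∧ p (Fin.last n) * ∏ j : Fin n, p (Fin.castSucc j) < 1}) → (∀ i, ∀ p ∈ (r i).domain, (r i).integrand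 p = 1) → (∀ i, (r' i).domain = {p : Fin (n + 1) → ℝ | (∀ j : Fin n, a' i j < p (Fin.castSucc j) ∧ p (Fin.castSucc j) < a' i j * (α ^ ((s i j : ℚ) : ℝ) * β ^ ((t i j : ℚ) : ℝ))) ∧ 0 < p (Fin.last n) ∧ p (Fin.last n) * ∏ j : Fin n, p (Fin.castSucc j) < 1}) → (∀ i, ∀ p ∈ (r' i).domain, (r' i).integrand p = 1) → ∑ i, (r i).value = ∑ i, (r' i).value → ∑ i, KZ.of (r i) - ∑ i, KZ.of (r' i) ∈ KZ.relations) → (∀ (α β : ℝ), 0 < α → 0 < β → IsAlgebraic ℚ α → IsAlgebraic ℚ β → (∀ p q : ℤ, α ^ p * β ^ q = 1 → p = 0 ∧ q = 0) → ∀ (k m k' m' : ℕ) (a : Fin k → Fin 2 → ℝ) (u v : Fin k → Fin 2 → ℚ) (ta tb tc : Fin m → ℝ) (ti tj : Fin m → ℕ) (tu tv : Fin m → ℚ) (a' : Fin k' → Fin 2 → ℝ) (u' v' : Fin k' → Fin 2 → ℚ) (ta' tb' tc' : Fin m' → ℝ) (ti' tj' : Fin m' → ℕ) (tu' tv' : Fin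 m' → ℚ) (rB : Fin k → KZ.IntegralRep 3) (rT : Fin m → KZ.IntegralRep 3) (rB' : Fin k' → KZ.IntegralRep 3) (rT' : Fin m' → KZ.IntegralRep 3), (∀ i j, 0 < a i j) → (∀ i j, IsAlgebraic ℚ (a i j)) → (∀ i j, 1 < α ^ ((u i j : ℚ) : ℝ) * β ^ ((v i j : ℚ) : ℝ)) → (∀ i, (rB i).domain = {p : Fin (2 + 1) → ℝ | (∀ j : Fin 2, a i j < p (Fin.castSucc j) ∧ p (Fin.castSucc j) < a i j * (α ^ ((u i j : ℚ) : ℝ) * β ^ ((v i j : ℚ) : ℝ))) ∧ 0 < p (Fin.last 2) ∧ p (Fin.last 2) * ∏ j : Fin 2, p (Fin.castSucc j) < 1}) → (∀ i, ∀ p ∈ (rB i).domain, (rB i).integrand p = 1) → (∀ ν, 0 < ta ν) → (∀ ν, 0 < tb ν) → (∀ ν, IsAlgebraic ℚ (ta ν)) → (∀ ν, IsAlgebraic ℚ (tb ν)) → (∀ ν, IsAlgebraic ℚ (tc ν)) → (∀ ν, 1 ≤ ti ν) → (∀ ν, 1 ≤ tj ν) → (∀ ν, tc ν = ta ν ^ ti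 ν * tb ν ^ tj ν * (α ^ ((tu ν : ℚ) : ℝ) * β ^ ((tv ν : ℚ) : ℝ))) → (∀ ν, 1 < α ^ ((tu ν : ℚ) : ℝ) * β ^ ((tv ν : ℚ) : ℝ)) → (∀ ν, (rT ν).domain = {p : Fin 3 → ℝ | ta ν < p 0 ∧ tb ν < p 1 ∧ p 0 ^ ti ν * p 1 ^ tj ν < tc ν ∧ 0 < p 2 ∧ p 2 * (p 0 * p 1) < 1}) → (∀ ν, ∀ p ∈ (rT ν).domain, (rT ν).integrand p = 1) → (∀ i j, 0 < a' i j) → (∀ i j, IsAlgebraic ℚ (a' i j)) → (∀ i j, 1 < α ^ ((u' i j : ℚ) : ℝ) * β ^ ((v' i j : ℚ) : ℝ)) → (∀ i, (rB' i).domain = {p : Fin (2 + 1) → ℝ | (∀ j : Fin 2, a' i j < p (Fin.castSucc j) ∧ p (Fin.castSucc j) < a' i j * (α ^ ((u' i j : ℚ) : ℝ) * β ^ ((v' i j : ℚ) : ℝ))) ∧ 0 < p (Fin.last 2) ∧ p (Fin.last 2) * ∏ j : Fin 2, p (Fin.castSucc j) < 1}) → (∀ i, ∀ p ∈ (rB'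 i).domain, (rB' i).integrand p = 1) → (∀ ν, 0 < ta' ν) → (∀ ν, 0 < tb' ν) → (∀ ν, IsAlgebraic ℚ (ta' ν)) → (∀ ν, IsAlgebraic ℚ (tb' ν)) → (∀ ν, IsAlgebraic ℚ (tc' ν)) → (∀ ν, 1 ≤ ti' ν) → (∀ ν, 1 ≤ tj' ν) → (∀ ν, tc' ν = ta' ν ^ ti' ν * tb' ν ^ tj' ν * (α ^ ((tu' ν : ℚ) : ℝ) * β ^ ((tv' ν : ℚ) : ℝ))) → (∀ ν, 1 < α ^ ((tu' ν : ℚ) : ℝ) * β ^ ((tv' ν : ℚ) : ℝ)) → (∀ ν, (rT' ν).domain = {p : Fin 3 → ℝ | ta' ν < p 0 ∧ tb' ν < p 1 ∧ p 0 ^ ti' ν * p 1 ^ tj' ν < tc' ν ∧ 0 < p 2 ∧ p 2 * (p 0 * p 1) < 1}) → (∀ ν, ∀ p ∈ (rT' ν).domain, (rT' ν).integrand p = 1) → ∑ ν, (rB ν).value + ∑ ν, (rT ν).value = ∑ ν, (rB' ν).value + ∑ ν, (rT' ν).value → (∑ ν, KZ.of (rB ν) + ∑ ν, KZ.of (rT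 ν)) - (∑ ν, KZ.of (rB' ν) + ∑ ν, KZ.of (rT' ν)) ∈ KZ.relations) := by
  intro hTri hPos α β hα hβ hαa hβa hind k m k' m' a u v ta tb tc ti tj tu tv a' u' v' ta' tb' tc'
    ti' tj' tu' tv' rB rT rB' rT' ha haa hlt hrBd hrBi hta htb htaa htba htca hti htj htc hltT hrTd
    hrTi ha' ha'a hlt' hrB'd hrB'i hta' htb' hta'a htb'a htc'a hti' htj' htc' hltT' hrT'd hrT'i hv
  obtain ⟨A, U, V, R, hA, hAa, hAlt, hRd, hRi, hRv, hRrel⟩ := mxs_side hTri hα hβ hαa hβa ha haa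
    hlt hrBd hrBi hta htb htaa htba htca hti htj htc hltT hrTd hrTi
  obtain ⟨A', U', V', R', hA', hA'a, hA'lt, hR'd, hR'i, hR'v, hR'rel⟩ := mxs_side hTri hα hβ hαa
    hβa ha' ha'a hlt' hrB'd hrB'i hta' htb' hta'a htb'a htc'a hti' htj' htc' hltT' hrT'd hrT'i
  have hout : ∑ i, KZ.of (R i) - ∑ i, KZ.of (R' i) ∈ KZ.relations :=
    hPos 2 α β hα hβ hαa hβa hind (k + m) (k' + m') A U V A' U' V' R R' hA hAa hAlt hA' hA'a hA'lt
      hRd hRi hR'd hR'i (by rw [hRv, hR'v]; exact hv)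
  have key : (∑ ν, KZ.of (rB ν) + ∑ ν, KZ.of (rT ν)) - (∑ ν, KZ.of (rB' ν) + ∑ ν, KZ.of (rT' ν)) =
      (∑ i, KZ.of (R i) - ∑ i, KZ.of (R' i)) -
        (∑ i, KZ.of (R i) - (∑ ν, KZ.of (rB ν) + ∑ ν, KZ.of (rT ν))) +
        (∑ i, KZ.of (R' i) - (∑ ν, KZ.of (rB' ν) + ∑ ν, KZ.of (rT' ν))) := by
    abel
  rw [key]
  exact KZ.relations.add_mem (KZ.relations.sub_mem hout hRrel) hR'rel

end Summit.KontsevichZagierPeriods.SymplecticScissors.LogPolytope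

end
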